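import Literature.Topology.FourManifolds.RankOneMapJets
import Literature.Analysis.Calculus.CurveCompThirdDeriv
import HarnessLib

/-!
# The split cusp model `(t, x, y, z) ↦ h(t, x) + ε₂ y² + ε₃ z²`: jets and Whitney's conditions

Topic `Literature/Topology/FourManifolds` (programme of the fact
`Literature.Topology.FourManifolds.exists_isSimplifiedBrokenLefschetzFibration`, Baykur–Saeki 2017, §2.1).
In a cusp-splitting chart (`CuspSplittingChart.HasCuspSplitChart`) a map `ℝ⁴ → ℝ²` reads
`y ↦ (y₀, fm y)` with the **split model function** `fm = cuspModelFn h ε₂ ε₃ :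
y ↦ h(y₀, y₁) + ε₂ y₂² + ε₃ y₃²`.  This file computes the jets of `fm` in terms of those of the
planar germ `h` and reads the three intrinsic conditions of the lane on `h`:

* `fderiv_cuspModelFn_apply`, `fderiv_fderiv_cuspModelFn_apply`,
  `fderiv_fderiv_fderiv_cuspModelFn_single_one` — `dfm`, `D²fm` and `D³fm(e₁, e₁, e₁)`
  (the last along the line `s ↦ s e₁`, by `CurveCompThirdDeriv`);
* **`whitney_conditions_of_cuspModel`** — if `y ↦ (y₀, fm y)` has at `0` a cusp candidate
  (`IsCuspCandidateAt`), is 1-jet-transverse and cusp-generic there, then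
  `∂ₓh(0) = 0`, `∂ₓ²h(0) = 0`, `∂ₜ∂ₓh(0) ≠ 0` and `∂ₓ³h(0) ≠ 0` — exactly the hypotheses of
  Whitney's planar cusp theorem (Golubitsky–Guillemin VI §2, proof of Thm. 2.4: `h_{x₂} =
  h_{x₂x₂} = 0`, `d(∂h/∂x₂)₀ ≠ 0`, `h_{x₂x₂x₂} ≠ 0`).

Everything is proved; `cuspModelFn`, `baseProj`, `quadPart`, `quadL` are the only definitions;
no named fact (D-0026).

## References

* M. Golubitsky, V. Guillemin, *Stable Mappings and Their Singularities*, GTM 14 (1973), Ch. VI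
  §2, proof of Thm. 2.4 (pp. 147–148). [GolubitskyGuillemin1973]
* R. İ. Baykur, O. Saeki, *Simplifying indefinite fibrations on 4-manifolds*, arXiv:1705.11169,
  §2.1, p. 6. [BaykurSaeki2017]
-/

noncomputable section

set_option maxSynthPendingDepth 2

open Set Function Filter
open scoped ContDiff Topology

namespace Literature.Topology.FourManifolds

namespace OneJet

open Literature.Analysis.Calculus

section

/-- Local notation for this file: the model space `ℝⁿ = EuclideanSpace ℝ (Fin n)`. -/
local notation "𝔼 " n:arg => EuclideanSpace ℝ (Fin n)

/-- Local notation: the coordinate covectors of `ℝ⁴`. -/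
local notation "π₄" => (EuclideanSpace.proj (𝕜 := ℝ) (ι := Fin 4))

/-! ### The model function and its parts -/

/-- The base projection `y ↦ (y₀, y₁)`. [folklore] -/
def baseProj : 𝔼 4 →L[ℝ] ℝ × ℝ := (π₄ 0).prod (π₄ 1)

/-- `baseProj y = (y₀, y₁)`. [folklore] -/
@[simp]
theorem baseProj_apply (y : 𝔼 4) : baseProj y = (y 0, y 1) := rfl

/-- The quadratic part `ε₂ y₂² + ε₃ y₃²`. [folklore] -/
def quadPart (ε₂ ε₃ : ℝ) (y : 𝔼 4) : ℝ := ε₂ * y 2 ^ 2 + ε₃ * y 3 ^ 2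

/-- The differential of the quadratic part, `y ↦ 2ε₂ y₂ e₂* + 2ε₃ y₃ e₃*`, a continuous linear
map of `y`. [folklore] -/
def quadL (ε₂ ε₃ : ℝ) : 𝔼 4 →L[ℝ] (𝔼 4 →L[ℝ] ℝ) :=
  (π₄ 2).smulRight ((2 * ε₂) • π₄ 2) + (π₄ 3).smulRight ((2 * ε₃) • π₄ 3)

/-- `quadL ε₂ ε₃ y v = 2ε₂ y₂ v₂ + 2ε₃ y₃ v₃`. [folklore] -/
@[simp]
theorem quadL_apply (ε₂ ε₃ : ℝ) (y v : 𝔼 4) :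
    quadL ε₂ ε₃ y v = 2 * ε₂ * y 2 * v 2 + 2 * ε₃ * y 3 * v 3 := by
  simp [quadL]
  ring

/-- **The split cusp model function** `fm y = h(y₀, y₁) + ε₂ y₂² + ε₃ y₃²`.
[cite: GolubitskyGuillemin1973, Ch. VI §2, (†) p. 147] -/
def cuspModelFn (h : ℝ × ℝ → ℝ) (ε₂ ε₃ : ℝ) : 𝔼 4 → ℝ :=
  fun y => h (y 0, y 1) + ε₂ * y 2 ^ 2 + ε₃ * y 3 ^ 2

/-- `cuspModelFn = h ∘ baseProj + quadPart`. [folklore] -/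
theorem cuspModelFn_eq (h : ℝ × ℝ → ℝ) (ε₂ ε₃ : ℝ) :
    cuspModelFn h ε₂ ε₃ = fun y => h (baseProj y) + quadPart ε₂ ε₃ y := by
  funext y
  simp [cuspModelFn, quadPart, add_assoc]

/-- The differential of the quadratic part. [folklore] -/
theorem hasFDerivAt_quadPart (ε₂ ε₃ : ℝ) (y : 𝔼 4) :
    HasFDerivAt (quadPart ε₂ ε₃) (quadL ε₂ ε₃ y) y := by
  have h2 : HasFDerivAt (fun y : 𝔼 4 => y 2 ^ 2) ((2 • y 2 ^ 1) • π₄ 2) y := (π₄ 2).hasFDerivAt.pow 2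
  have h3 : HasFDerivAt (fun y : 𝔼 4 => y 3 ^ 2) ((2 • y 3 ^ 1) • π₄ 3) y := (π₄ 3).hasFDerivAt.pow 2
  refine ((h2.const_mul ε₂).add (h3.const_mul ε₃)).congr_fderiv ?_
  ext v
  simp
  ring

/-- `d(quadPart) = quadL`. [folklore] -/
theorem fderiv_quadPart (ε₂ ε₃ : ℝ) : fderiv ℝ (quadPart ε₂ ε₃) = fun y => quadL ε₂ ε₃ y :=
  funext fun y => (hasFDerivAt_quadPart ε₂ ε₃ y).fderiv

/-- `quadPart` is `C^∞`. [folklore] -/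
theorem contDiff_quadPart (ε₂ ε₃ : ℝ) : ContDiff ℝ ∞ (quadPart ε₂ ε₃) :=
  (contDiff_const.mul ((π₄ 2).contDiff.pow 2)).add (contDiff_const.mul ((π₄ 3).contDiff.pow 2))

variable {h : ℝ × ℝ → ℝ} {U : Set (ℝ × ℝ)} {ε₂ ε₃ : ℝ}

/-- The model function is `C^∞` over `baseProj ⁻¹' U`. [folklore] -/
theorem contDiffOn_cuspModelFn (hh : ContDiffOn ℝ ∞ h U) (ε₂ ε₃ : ℝ) :
    ContDiffOn ℝ ∞ (cuspModelFn h ε₂ ε₃) (baseProj ⁻¹' U) := by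
  rw [cuspModelFn_eq]
  exact (hh.comp baseProj.contDiff.contDiffOn fun y hy => hy).add (contDiff_quadPart ε₂ ε₃).contDiffOn

/-- **The differential of the model function**: `dfm_y = dh_{(y₀,y₁)} ∘ baseProj + quadL y`.
[folklore] -/
theorem hasFDerivAt_cuspModelFn (hU : IsOpen U) (hh : ContDiffOn ℝ ∞ h U) {y : 𝔼 4}
    (hy : y ∈ baseProj ⁻¹' U) :
    HasFDerivAt (cuspModelFn h ε₂ ε₃)
      ((fderiv ℝ h (baseProj y)).comp baseProj + quadL ε₂ ε₃ y) y := by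
  rw [cuspModelFn_eq]
  have hhd : HasFDerivAt h (fderiv ℝ h (baseProj y)) (baseProj y) :=
    ((hh.contDiffAt (hU.mem_nhds hy)).differentiableAt (by simp)).hasFDerivAt
  exact (hhd.comp y baseProj.hasFDerivAt).add (hasFDerivAt_quadPart ε₂ ε₃ y)

/-- `dfm_y v = dh_{(y₀,y₁)}(v₀, v₁) + 2ε₂ y₂ v₂ + 2ε₃ y₃ v₃`. [folklore] -/
theorem fderiv_cuspModelFn_apply (hU : IsOpen U) (hh : ContDiffOn ℝ ∞ h U) {y : 𝔼 4}
    (hy : y ∈ baseProj ⁻¹' U) (v : 𝔼 4) :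
    fderiv ℝ (cuspModelFn h ε₂ ε₃) y v =
      fderiv ℝ h (y 0, y 1) (v 0, v 1) + (2 * ε₂ * y 2 * v 2 + 2 * ε₃ * y 3 * v 3) := by
  rw [(hasFDerivAt_cuspModelFn hU hh hy).fderiv]
  simp

/-- **The second differential of the model function**:
`D²fm_y(v, w) = D²h_{(y₀,y₁)}((v₀,v₁),(w₀,w₁)) + 2ε₂ v₂ w₂ + 2ε₃ v₃ w₃`. [folklore] -/
theorem fderiv_fderiv_cuspModelFn_apply (hU : IsOpen U) (hh : ContDiffOn ℝ ∞ h U) {y : 𝔼 4}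
    (hy : y ∈ baseProj ⁻¹' U) (v w : 𝔼 4) :
    fderiv ℝ (fderiv ℝ (cuspModelFn h ε₂ ε₃)) y v w =
      fderiv ℝ (fderiv ℝ h) (y 0, y 1) (v 0, v 1) (w 0, w 1) +
        (2 * ε₂ * v 2 * w 2 + 2 * ε₃ * v 3 * w 3) := by
  have hΩ : IsOpen (baseProj ⁻¹' U : Set (𝔼 4)) := hU.preimage baseProj.continuous
  have heq : fderiv ℝ (cuspModelFn h ε₂ ε₃) =ᶠ[𝓝 y]
      fun z => (ContinuousLinearMap.compL ℝ (𝔼 4) (ℝ × ℝ) ℝ).flip baseProj (fderiv ℝ h (baseProj z)) +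
        quadL ε₂ ε₃ z := by
    filter_upwards [hΩ.mem_nhds hy] with z hz
    rw [(hasFDerivAt_cuspModelFn hU hh hz).fderiv]
    rfl
  rw [heq.fderiv_eq]
  have hh' : ContDiffOn ℝ ∞ (fderiv ℝ h) U := hh.fderiv_of_isOpen hU (by simp)
  have hd : HasFDerivAt (fderiv ℝ h) (fderiv ℝ (fderiv ℝ h) (baseProj y)) (baseProj y) :=
    ((hh'.contDiffAt (hU.mem_nhds hy)).differentiableAt (by simp)).hasFDerivAt
  have h1 : HasFDerivAt (fun z : 𝔼 4 =>
      (ContinuousLinearMap.compL ℝ (𝔼 4) (ℝ × ℝ) ℝ).flip baseProj (fderiv ℝ h (baseProj z)))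
      (((ContinuousLinearMap.compL ℝ (𝔼 4) (ℝ × ℝ) ℝ).flip baseProj).comp
        ((fderiv ℝ (fderiv ℝ h) (baseProj y)).comp baseProj)) y :=
    ((ContinuousLinearMap.compL ℝ (𝔼 4) (ℝ × ℝ) ℝ).flip baseProj).hasFDerivAt.comp y
      (hd.comp y baseProj.hasFDerivAt)
  have hsum : HasFDerivAt (fun z : 𝔼 4 =>
      (ContinuousLinearMap.compL ℝ (𝔼 4) (ℝ × ℝ) ℝ).flip baseProj (fderiv ℝ h (baseProj z)) +
        quadL ε₂ ε₃ z)
      (((ContinuousLinearMap.compL ℝ (𝔼 4) (ℝ × ℝ) ℝ).flip baseProj).comp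
        ((fderiv ℝ (fderiv ℝ h) (baseProj y)).comp baseProj) + quadL ε₂ ε₃) y :=
    h1.add (quadL ε₂ ε₃).hasFDerivAt
  rw [hsum.fderiv]
  simp [ContinuousLinearMap.compL_apply]

/-- `3 ≤ ∞` in `WithTop ℕ∞`. [folklore] -/
private theorem three_le_infty₅ : (3 : WithTop ℕ∞) ≤ ∞ := WithTop.coe_le_coe.2 le_top

/-- Third derivative along a straight line: `(F ∘ (s ↦ x + s e))''' = D³F(x + s e)(e, e, e)`.
[folklore] -/
theorem deriv3_comp_line {E : Type*} [NormedAddCommGroup E] [NormedSpace ℝ E] {F : E → ℝ}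
    {Ω : Set E} (hΩ : IsOpen Ω) (hF : ContDiffOn ℝ ∞ F Ω) {x e : E} (hx : x ∈ Ω) :
    deriv (deriv (deriv fun s : ℝ => F (x + s • e))) 0 =
      fderiv ℝ (fderiv ℝ (fderiv ℝ F)) x e e e := by
  set γ : ℝ → E := fun s => x + s • e with hγ
  set I : Set ℝ := γ ⁻¹' Ω with hI
  have hγs : ContDiff ℝ ∞ γ := contDiff_const.add (contDiff_id.smul contDiff_const)
  have hIo : IsOpen I := hΩ.preimage hγs.continuous
  have h0I : (0 : ℝ) ∈ I := by simp [hI, hγ, hx]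
  have hd1 : deriv γ = fun _ => e := by
    funext s
    have : HasDerivAt γ e s := by
      simpa [hγ] using ((hasDerivAt_id s).smul_const e).const_add x
    exact this.deriv
  have h := deriv_deriv_deriv_comp_curve hIo hΩ three_le_infty₅ hF hγs.contDiffOn
    (fun s hs => hs) h0I
  have hγ0 : γ 0 = x := by simp [hγ]
  rw [show (fun s : ℝ => F (x + s • e)) = F ∘ γ from rfl, h]
  simp only [hd1]
  simp [hγ0]

/-- **The third derivative of the model function along `e₁`** is `∂ₓ³h`:
`D³fm_0(e₁, e₁, e₁) = D³h_0((0,1),(0,1),(0,1))`. [folklore] -/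
theorem fderiv_fderiv_fderiv_cuspModelFn_single_one (hU : IsOpen U) (h0 : (0 : ℝ × ℝ) ∈ U)
    (hh : ContDiffOn ℝ ∞ h U) :
    fderiv ℝ (fderiv ℝ (fderiv ℝ (cuspModelFn h ε₂ ε₃))) 0 (EuclideanSpace.single (1 : Fin 4) (1 : ℝ))
        (EuclideanSpace.single (1 : Fin 4) (1 : ℝ)) (EuclideanSpace.single (1 : Fin 4) (1 : ℝ)) =
      fderiv ℝ (fderiv ℝ (fderiv ℝ h)) 0 ((0 : ℝ), (1 : ℝ)) ((0 : ℝ), (1 : ℝ)) ((0 : ℝ), (1 : ℝ)) := by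
  have hΩ : IsOpen (baseProj ⁻¹' U : Set (𝔼 4)) := hU.preimage baseProj.continuous
  have h0Ω : (0 : 𝔼 4) ∈ (baseProj ⁻¹' U : Set (𝔼 4)) := by
    show baseProj 0 ∈ U
    rw [map_zero]
    exact h0
  rw [← deriv3_comp_line hΩ (contDiffOn_cuspModelFn hh ε₂ ε₃) h0Ω,
    ← deriv3_comp_line hU hh h0]
  congr 1
  funext s
  simp [cuspModelFn]

/-! ### Whitney's conditions read on the model -/

/-- The fibre vectors `e₁, e₂, e₃` of `ℝ⁴`. [folklore] -/
private theorem single_succ_apply_zero (i : Fin 3) :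
    (EuclideanSpace.single (Fin.succ i) (1 : ℝ) : 𝔼 4) 0 = 0 := by
  simp [Fin.succ_ne_zero]

/-- **Whitney's conditions for the planar germ of a split cusp.**  Let `h` be `C^∞` on the open
`U ∋ 0`, `ε₂, ε₃ ≠ 0`, and suppose the rank-one map `y ↦ (y₀, h(y₀,y₁) + ε₂ y₂² + ε₃ y₃²)` has
at `0` a cusp candidate, is 1-jet-transverse and cusp-generic there.  Then
`∂ₓh(0) = 0`, `∂ₓ²h(0) = 0`, `∂ₜ∂ₓh(0) ≠ 0` and `∂ₓ³h(0) ≠ 0`.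
[cite: GolubitskyGuillemin1973, Ch. VI §2, proof of Thm. 2.4] -/
theorem whitney_conditions_of_cuspModel (hU : IsOpen U) (h0 : (0 : ℝ × ℝ) ∈ U)
    (hh : ContDiffOn ℝ ∞ h U) (hε₂ : ε₂ ≠ 0) (hε₃ : ε₃ ≠ 0)
    (hcc : IsCuspCandidateAt (rankOneMap (cuspModelFn h ε₂ ε₃)) 0)
    (htr : IsOneJetTransverseAt (rankOneMap (cuspModelFn h ε₂ ε₃)) 0)
    (hcg : IsCuspGenericAt (rankOneMap (cuspModelFn h ε₂ ε₃)) 0) :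
    fderiv ℝ h 0 ((0 : ℝ), (1 : ℝ)) = 0 ∧
      fderiv ℝ (fderiv ℝ h) 0 ((0 : ℝ), (1 : ℝ)) ((0 : ℝ), (1 : ℝ)) = 0 ∧
      fderiv ℝ (fderiv ℝ h) 0 ((1 : ℝ), (0 : ℝ)) ((0 : ℝ), (1 : ℝ)) ≠ 0 ∧
      fderiv ℝ (fderiv ℝ (fderiv ℝ h)) 0 ((0 : ℝ), (1 : ℝ)) ((0 : ℝ), (1 : ℝ)) ((0 : ℝ), (1 : ℝ)) ≠ 0 := by
  set fm := cuspModelFn h ε₂ ε₃ with hfm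
  set Ω : Set (𝔼 4) := baseProj ⁻¹' U with hΩdef
  have hΩ : IsOpen Ω := hU.preimage baseProj.continuous
  have h0Ω : (0 : 𝔼 4) ∈ Ω := by
    show baseProj 0 ∈ U
    rw [map_zero]
    exact h0
  have hfs : ContDiffOn ℝ ∞ fm Ω := contDiffOn_cuspModelFn hh ε₂ ε₃
  set e1 : 𝔼 4 := EuclideanSpace.single (1 : Fin 4) (1 : ℝ) with he1
  set e2 : 𝔼 4 := EuclideanSpace.single (2 : Fin 4) (1 : ℝ) with he2
  set e3 : 𝔼 4 := EuclideanSpace.single (3 : Fin 4) (1 : ℝ) with he3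
  -- the jets of `fm` at `0`
  have hD1 : ∀ v : 𝔼 4, fderiv ℝ fm 0 v = fderiv ℝ h 0 (v 0, v 1) := fun v => by
    rw [hfm, fderiv_cuspModelFn_apply hU hh h0Ω]
    simp [Prod.mk_zero_zero]
  have hD2 : ∀ v w : 𝔼 4, fderiv ℝ (fderiv ℝ fm) 0 v w =
      fderiv ℝ (fderiv ℝ h) 0 (v 0, v 1) (w 0, w 1) + (2 * ε₂ * v 2 * w 2 + 2 * ε₃ * v 3 * w 3) :=
    fun v w => by
    rw [hfm, fderiv_fderiv_cuspModelFn_apply hU hh h0Ω]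
    simp [Prod.mk_zero_zero]
  have hDe1 : ∀ v : 𝔼 4, fderiv ℝ (fderiv ℝ fm) 0 v e1 =
      fderiv ℝ (fderiv ℝ h) 0 (v 0, v 1) ((0 : ℝ), (1 : ℝ)) := fun v => by
    rw [hD2]
    simp [he1]
  -- linearity of `D²h_0(·, (0,1))` in the first slot along the base
  have hlin : ∀ v : 𝔼 4, fderiv ℝ (fderiv ℝ h) 0 (v 0, v 1) ((0 : ℝ), (1 : ℝ)) =
      v 0 * fderiv ℝ (fderiv ℝ h) 0 ((1 : ℝ), (0 : ℝ)) ((0 : ℝ), (1 : ℝ)) +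
        v 1 * fderiv ℝ (fderiv ℝ h) 0 ((0 : ℝ), (1 : ℝ)) ((0 : ℝ), (1 : ℝ)) := fun v => by
    have : ((v 0, v 1) : ℝ × ℝ) = v 0 • ((1 : ℝ), (0 : ℝ)) + v 1 • ((0 : ℝ), (1 : ℝ)) := by
      ext <;> simp
    rw [this, map_add, map_smul, map_smul, _root_.add_apply, _root_.smul_apply, _root_.smul_apply,
      smul_eq_mul, smul_eq_mul]
  -- (1) `∂ₓh(0) = 0` from criticality
  obtain ⟨hcrit, k₀, hk₀0, hk₀, hrad⟩ :=
    (isCuspCandidateAt_rankOneMap_iff hΩ hfs h0Ω).1 hcc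
  have h1 : fderiv ℝ h 0 ((0 : ℝ), (1 : ℝ)) = 0 := by
    have := hcrit e1 (by simp [he1])
    rw [hD1] at this
    simpa [he1] using this
  -- (2) the radical vector is a multiple of `e₁`, and `∂ₓ²h(0) = 0`
  have hk2 : k₀ 2 = 0 := by
    have := hrad e2 (by simp [he2])
    rw [hD2] at this
    simpa [he2, Prod.mk_zero_zero, hε₂] using this
  have hk3 : k₀ 3 = 0 := by
    have := hrad e3 (by simp [he3])
    rw [hD2] at this
    simpa [he3, Prod.mk_zero_zero, hε₃] using this
  have hk1 : k₀ 1 ≠ 0 := by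
    intro hk1
    apply hk₀0
    ext i
    fin_cases i
    · simpa using hk₀
    · simpa using hk1
    · simpa using hk2
    · simpa using hk3
  have h2 : fderiv ℝ (fderiv ℝ h) 0 ((0 : ℝ), (1 : ℝ)) ((0 : ℝ), (1 : ℝ)) = 0 := by
    have := hrad e1 (by simp [he1])
    rw [hD2] at this
    have hk : ((k₀ 0, k₀ 1) : ℝ × ℝ) = k₀ 1 • ((0 : ℝ), (1 : ℝ)) := by
      ext <;> simp [hk₀]
    rw [hk, map_smul, smul_eq_mul] at this
    simpa [he1, hk2, hk3, hk1] using this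
  -- (3) `∂ₜ∂ₓh(0) ≠ 0` from 1-jet transversality applied to `e₁`
  have htrk := (isOneJetTransverseAt_rankOneMap_iff hΩ hfs h0Ω hcrit).1 htr
  have h3 : fderiv ℝ (fderiv ℝ h) 0 ((1 : ℝ), (0 : ℝ)) ((0 : ℝ), (1 : ℝ)) ≠ 0 := by
    intro h3
    have he10 : e1 ≠ 0 := by
      intro h0'
      have := congrArg (fun v : 𝔼 4 => v 1) h0'
      simp [he1] at this
    refine he10 (htrk e1 (by simp [he1]) fun v => ?_)
    rw [hDe1, hlin v, h2, h3, mul_zero, mul_zero, add_zero]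
  -- (4) `∂ₓ³h(0) ≠ 0` from cusp-genericity applied to the radical vector `e₁`
  have hcgk := (isCuspGenericAt_rankOneMap_iff hΩ hfs h0Ω hcrit).1 hcg
  have he1rad : ∀ k : 𝔼 4, k 0 = 0 → fderiv ℝ (fderiv ℝ fm) 0 k e1 = 0 := by
    intro k hk
    rw [hDe1, hlin k, hk, h2, zero_mul, mul_zero, add_zero]
  have h4 := hcgk e1 (by
      intro h0'
      have := congrArg (fun v : 𝔼 4 => v 1) h0'
      simp [he1] at this) (by simp [he1]) he1rad
  rw [hfm, he1, fderiv_fderiv_fderiv_cuspModelFn_single_one hU h0 hh] at h4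
  exact ⟨h1, h2, h3, h4⟩

end

end OneJet

end Literature.Topology.FourManifolds
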